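import Mathlib

/-!
# Stub `stub_familyPoint` — a family is a feasible kernel (`α ≤ ϑ⁺`)

Crux stmt-MatrixMultiplication-14309 (`PrimeCyclicPowerGain`), line
`clique-coclique-direct-sum-clique`, registered stub `stub_familyPoint`.

This is the easy direction `α ≤ ϑ⁺` of the Schrijver–Lovász theta body: an actual family is a
feasible kernel.  Concretely, "feasible kernels" `B : V → V → ℝ` are symmetric, positive
semidefinite as a real quadratic form, entrywise nonnegative, diagonally dominant
(`B v w ≤ B v v`), supported on a relation `P`, and of trace `1`.  If every feasible kernel has
total sum `∑ v, ∑ w, B v w ≤ T`, then every finite set `S` of pairwise `P`-related vertices has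
`|S| ≤ T`: for `S ≠ ∅` the kernel `B_S v w = [v ∈ S] [w ∈ S] / |S|` is feasible, its quadratic
form is `x ↦ (∑_{v ∈ S} x v)² / |S| ≥ 0`, its trace is `1` and its total sum is `|S|`; for
`S = ∅` the claim is `0 ≤ T`.

Mathlib only; no `def`s (the indicator `e` and the kernel `B` are introduced inside the proof as
witnesses of existentials, so all their properties are plain rewriting lemmas).
-/

namespace Summit.MatrixMultiplication.MatrixMultiplication.Theorems.PrimeCyclicPowerGainTheta.FamilyPoint

open Finset
open scoped BigOperators

/-- The quadratic form of a rank-one kernel `(v, w) ↦ e v * e w * c` is `c · (∑ x·e)²`. -/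
theorem sum_sum_rank_one {V : Type} [Fintype V] (e x : V → ℝ) (c : ℝ) :
    ∑ v, ∑ w, x v * (e v * e w * c) * x w = c * (∑ v, x v * e v) ^ 2 := by
  rw [sq, Finset.sum_mul_sum, Finset.mul_sum]
  refine Finset.sum_congr rfl fun v _ => ?_
  rw [Finset.mul_sum]
  refine Finset.sum_congr rfl fun w _ => ?_
  ring

/-- The total sum of a rank-one kernel `(v, w) ↦ e v * e w * c` is `c · (∑ e)²`. -/
theorem sum_sum_rank_one' {V : Type} [Fintype V] (e : V → ℝ) (c : ℝ) :
    ∑ v, ∑ w, e v * e w * c = c * (∑ v, e v) ^ 2 := by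
  have h := sum_sum_rank_one e (fun _ => (1 : ℝ)) c
  simpa using h

/-- **stub_familyPoint** (the easy direction `α ≤ ϑ⁺` of the Schrijver–Lovász theta body).
A finite set `S` of pairwise `P`-related vertices is a feasible point of the relaxation:
`B_S v w = [v ∈ S][w ∈ S]/|S|` is symmetric, PSD (`x ↦ (Σ_{v∈S} x_v)²/|S|`), nonnegative,
diagonally dominant, supported in `P`, of trace `1`, and `Σ B_S = |S|`; so a uniform bound `T` on
feasible kernels bounds `|S|`. -/
theorem stub_familyPoint :
    ∀ (V : Type) [Fintype V] (P : V → V → Prop) (T : ℝ) (S : Finset V),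
      0 ≤ T →
      (∀ v ∈ S, ∀ w ∈ S, P v w) →
      (∀ B : V → V → ℝ,
          (∀ v w, B v w = B w v) →
          (∀ x : V → ℝ, 0 ≤ ∑ v, ∑ w, x v * B v w * x w) →
          (∀ v w, 0 ≤ B v w) →
          (∀ v w, B v w ≤ B v v) →
          (∀ v w, B v w ≠ 0 → P v w) →
          ∑ v, B v v = 1 →
          ∑ v, ∑ w, B v w ≤ T) →
      (S.card : ℝ) ≤ T := by
  intro V _ P T S hT hP hbig
  classical
  rcases S.eq_empty_or_nonempty with rfl | hne
  · simpa using hT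
  -- `m = |S| > 0`, `c = m⁻¹`
  have hm : (0 : ℝ) < S.card := by exact_mod_cast hne.card_pos
  have hm0 : (S.card : ℝ) ≠ 0 := hm.ne'
  have hc : (0 : ℝ) ≤ (S.card : ℝ)⁻¹ := inv_nonneg.mpr hm.le
  -- the indicator of `S`
  obtain ⟨e, he⟩ : ∃ e : V → ℝ, ∀ v, e v = if v ∈ S then 1 else 0 := ⟨_, fun _ => rfl⟩
  have he_mem : ∀ {v}, v ∈ S → e v = 1 := fun hv => by rw [he, if_pos hv]
  have he_not : ∀ {v}, v ∉ S → e v = 0 := fun hv => by rw [he, if_neg hv]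
  have he_nn : ∀ v, 0 ≤ e v := fun v => by
    by_cases hv : v ∈ S
    · rw [he_mem hv]; exact zero_le_one
    · rw [he_not hv]
  have he_le : ∀ v, e v ≤ 1 := fun v => by
    by_cases hv : v ∈ S
    · rw [he_mem hv]
    · rw [he_not hv]; exact zero_le_one
  have he_sq : ∀ v, e v * e v = e v := fun v => by
    by_cases hv : v ∈ S
    · rw [he_mem hv, mul_one]
    · rw [he_not hv, mul_zero]
  have he_sum : ∑ v, e v = S.card := by
    have : ∑ v, e v = ∑ v, if v ∈ S then (1 : ℝ) else 0 := Finset.sum_congr rfl fun v _ => he v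
    rw [this, Finset.sum_ite_mem, Finset.univ_inter, Finset.sum_const, nsmul_eq_mul, mul_one]
  -- the kernel `B_S`
  obtain ⟨B, hB⟩ : ∃ B : V → V → ℝ, ∀ v w, B v w = e v * e w * (S.card : ℝ)⁻¹ :=
    ⟨_, fun _ _ => rfl⟩
  -- symmetric
  have hsymm : ∀ v w, B v w = B w v := fun v w => by rw [hB, hB, mul_comm (e v)]
  -- positive semidefinite
  have hpsd : ∀ x : V → ℝ, 0 ≤ ∑ v, ∑ w, x v * B v w * x w := fun x => by
    have : ∑ v, ∑ w, x v * B v w * x w = ∑ v, ∑ w, x v * (e v * e w * (S.card : ℝ)⁻¹) * x w :=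
      Finset.sum_congr rfl fun v _ => Finset.sum_congr rfl fun w _ => by rw [hB]
    rw [this, sum_sum_rank_one]
    exact mul_nonneg hc (sq_nonneg _)
  -- entrywise nonnegative
  have hnn : ∀ v w, 0 ≤ B v w := fun v w => by
    rw [hB]
    exact mul_nonneg (mul_nonneg (he_nn v) (he_nn w)) hc
  -- diagonally dominant
  have hdom : ∀ v w, B v w ≤ B v v := fun v w => by
    rw [hB, hB]
    refine mul_le_mul_of_nonneg_right ?_ hc
    by_cases hv : v ∈ S
    · rw [he_mem hv, one_mul, one_mul]; exact he_le w
    · rw [he_not hv, zero_mul, zero_mul]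
  -- supported on `P`
  have hsupp : ∀ v w, B v w ≠ 0 → P v w := fun v w h => by
    rw [hB] at h
    have hv : v ∈ S := by
      by_contra hv
      exact h (by rw [he_not hv, zero_mul, zero_mul])
    have hw : w ∈ S := by
      by_contra hw
      exact h (by rw [he_not hw, mul_zero, zero_mul])
    exact hP v hv w hw
  -- trace one
  have htr : ∑ v, B v v = 1 := by
    have : ∑ v, B v v = ∑ v, e v * (S.card : ℝ)⁻¹ :=
      Finset.sum_congr rfl fun v _ => by rw [hB, he_sq]
    rw [this, ← Finset.sum_mul, he_sum, mul_inv_cancel₀ hm0]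
  -- total sum `|S|`
  have htot : ∑ v, ∑ w, B v w = S.card := by
    have : ∑ v, ∑ w, B v w = ∑ v, ∑ w, e v * e w * (S.card : ℝ)⁻¹ :=
      Finset.sum_congr rfl fun v _ => Finset.sum_congr rfl fun w _ => by rw [hB]
    rw [this, sum_sum_rank_one', he_sum, sq, ← mul_assoc, inv_mul_cancel₀ hm0, one_mul]
  -- feed `B_S` to the uniform bound
  have key := hbig B hsymm hpsd hnn hdom hsupp htr
  rwa [htot] at key

end Summit.MatrixMultiplication.MatrixMultiplication.Theorems.PrimeCyclicPowerGainTheta.FamilyPoint
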